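import Literature.NumberTheory.GaloisCohomology.BrauerSumTwoTorsionFiniteSet
import Literature.NumberTheory.GaloisRepresentations.UnramifiedCupProductZero
import Literature.NumberTheory.GaloisRepresentations.CoinducedDiscreteGaloisModule
import Literature.NumberTheory.GaloisRepresentations.ContinuousShapiroLiftVanishing
import Literature.NumberTheory.GaloisRepresentations.ContinuousCupProductCompat
import Literature.NumberTheory.GaloisRepresentations.ContinuousH1ResCocycle
import HarnessLib

/-!
# Local terms of the reciprocity law for a cup product `a ∪ b ∈ H²(Γ_K, μₙ)`: vanishing at an unramified finite place,
# at a real place where one factor dies, and the Shapiro-lift criterion for being unramified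

Topic `NumberTheory/GaloisCohomology`; namespace `Literature.NumberTheory.GaloisCohomology`. THEOREMS ONLY (no definition, no
named fact, no instance, no `sorry`). Number fields in `Type` (as in `PoitouTateNumberField.lean`). Sequel to
`BrauerSumTwoTorsionFiniteSet.lean` (`2 • Σ_{v ∈ T} inv_v = 0`, `Σ_{v ∈ T} inv_v = −Σ_{w ∣ ∞} inv_w`).

For a number field `K`, discrete `Γ_K`-modules `M₁, M₂`, a continuous equivariant pairing `P : M₁ × M₂ → μₙ` and global classes
`a ∈ H¹(K, M₁)`, `b ∈ H¹(K, M₂)`: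

* §1 `localization_cupProduct_eq_zero_of_mem_unramifiedSubgroup` — **(U)** at a finite place `v` where BOTH localisations are
  unramified and `n` is a power of a prime `p`, `loc_v(a ∪ b) = 0` (`cupProduct_res` + the tree's
  `ContPairing.cupProduct_eq_zero_of_mem_unramifiedSubgroup`, Milne ADT I 2.6 — any finite module, the value group being
  `p`-primary);
* §2 `localization_inl_cupProduct_eq_zero_of_right` / `_of_left` — **(AR)** at an infinite place `w` where one factor dies,
  `loc_w(a ∪ b) = 0`; hence (`sum_localInvariantMap_cupProduct_eq_zero_of_right`) the EXACT reciprocity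
  `Σ_{v ∈ T} inv_v loc_v(a ∪ b) = 0` when the invariants vanish at the finite `v ∉ T` and `loc_w b = 0` at every infinite `w`;
* §3 `localization_shapiroLift_mem_unramifiedSubgroup` — **(ShU)**: for an open subgroup `U ≤ Γ_K` of finite index, a
  continuous crossed homomorphism `ψ : U → M` and its Shapiro lift `Sh ψ ∈ H¹(Γ_K, Maps(Γ_K ⧸ U, M))` (`shapiroLift`, coefficients
  the coinduced module `ρ.coind U`), `loc_v(Sh ψ)` is UNRAMIFIED at the finite place `v` as soon as every conjugate
  `i ↦ ψ(s(y₀)⁻¹ · i|_{K̄} · s(y₀))` is principal on the INERTIA group `I_v ≤ Γ_{K_v}` (orbit-by-orbit coboundary: the tree's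
  `exists_shapiroCocycle_comp_eq_coboundary_of_reps` along `I_v → Γ_{K_v} → Γ_K`, read through
  `oneCocycleClass_mem_unramifiedSubgroup_iff_exists`);
* §4 `two_nsmul_sum_localInvariantMap_cupProduct_shapiroLift_eq_zero` (and the exact `sum_…_eq_zero_of_right`) — the composed
  **core identity**: for two Shapiro lifts whose conjugates are principal on inertia at every finite place outside `T`,
  `2 • Σ_{v ∈ T} inv_v loc_v(Sh ψ₁ ∪ Sh ψ₂) = 0`, and `= 0` exactly if moreover `loc_w(Sh ψ₂) = 0` at every infinite `w`.

Consumer: the reciprocity stub `stub_reciprocity` (EH) of crux RSL_g `ResidualSignedLambdaLowerCMAtTwo` (`Summits/BirchSwinnertonDyer`,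
route `ResidualThetaTransportAtTwo`): Tate–Poitou along the layers `ℚ_n` of the cyclotomic `ℤ₂`-tower in the Shapiro model for an
`S₀`-relaxed Selmer structure, `T = {2} ∪ S₀`; the `T`-terms are then evaluated by the one-orbit / all-orbit Mackey formulas
(`ContinuousShapiroLiftRestrictHom`, `ContinuousShapiroLiftMackeyCup`). §1–§2 are adapted from the kernel-checked crux sketch
`Cruxes/ResidualThetaCountLowerPureAtTwo/Sketch_sidea_k1_g10.lean` §S (stub-ideation seat k1 gen 10); §3 was its open signature (ShU).

## References
* J. S. Milne, *Arithmetic Duality Theorems*, 2nd ed. (2006), Ch. I Thm. 2.6, Thm. 4.10 (b). [MilneADT2006]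
* J. Neukirch, A. Schmidt, K. Wingberg, *Cohomology of Number Fields*, 2nd ed. (2008), I §5 (1.5.6)–(1.5.7), I §6 Prop. (1.6.4),
  VIII §1 (Poitou–Tate). [NeukirchSchmidtWingberg2008]
* J.-P. Serre, *Local Fields* (1979), VII §5–§6; *Galois Cohomology* (1997), I §2.4, II §6.1. [SerreLocalFields1979]
-/

noncomputable section

open CategoryTheory Function Field NumberField IsDedekindDomain
open scoped NumberField

namespace Literature.NumberTheory.GaloisCohomology

open _root_.ContinuousCohomology _root_.TopRep
open Literature.NumberTheory.GaloisRepresentations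
open Literature.NumberTheory.GaloisRepresentations.DiscreteGaloisModule

variable (K : Type) [Field K] [NumberField K] (n : ℕ) [NeZero n]

/-! ## §1 (U): unramified ⊥ unramified, localised -/

/-- **(U) `loc_v(a ∪ b) = 0` when both localisations are unramified** (`n` a power of the prime `p`): for discrete `Γ_K`-modules
`M₁, M₂`, a continuous equivariant pairing `P : M₁ × M₂ → μₙ` and global classes `a, b` whose localisations at the finite place
`v` lie in `H¹_ur(K_v, ·)`, the localisation at `v` of `a ∪ b` vanishes (`loc_v(a ∪ b) = loc_v a ∪ loc_v b`, and unramified classes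
are orthogonal for ANY finite `p`-primary value module). [cite: MilneADT2006, Ch. I, Thm. 2.6] -/
theorem localization_cupProduct_eq_zero_of_mem_unramifiedSubgroup {p : ℕ} [Fact p.Prime] (hn : ∃ r : ℕ, n = p ^ r)
    {M₁ M₂ : Type} [AddCommGroup M₁] [TopologicalSpace M₁] [DiscreteTopology M₁]
    [AddCommGroup M₂] [TopologicalSpace M₂] [DiscreteTopology M₂]
    (ρ₁ : DiscreteGaloisModule K M₁) (ρ₂ : DiscreteGaloisModule K M₂)
    (P : ContPairing ρ₁.toTopRep ρ₂.toTopRep (mu K n).toTopRep) (v : HeightOneSpectrum (𝓞 K))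
    (a : galoisCohomology ρ₁ 1) (b : galoisCohomology ρ₂ 1)
    (ha : galoisCohomology.localization ρ₁ (Sum.inr v) 1 a ∈ unramifiedSubgroup (GaloisRep.toLocal v ρ₁) 1)
    (hb : galoisCohomology.localization ρ₂ (Sum.inr v) 1 b ∈ unramifiedSubgroup (GaloisRep.toLocal v ρ₂) 1) :
    galoisCohomology.localization (mu K n) (Sum.inr v) 2 (P.cupProduct a b) = 0 := by
  obtain ⟨r, rfl⟩ := hn
  have hC : IsPrimaryTorsion p (MuCarrier K (p ^ r)) := fun m ↦ ⟨r, by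
    rw [← natCast_zsmul]
    exact zsmul_muCarrier_eq_zero K (p ^ r) m⟩
  haveI : CompactSpace (absoluteGaloisGroup (v.adicCompletion K)) := absoluteGaloisGroup_compactSpace _
  refine (ContPairing.cupProduct_res P (absGaloisRestrict K (v.adicCompletion K)) a b).trans ?_
  exact ContPairing.cupProduct_eq_zero_of_mem_unramifiedSubgroup (ρ₁ := GaloisRep.toLocal v ρ₁) (ρ₂ := GaloisRep.toLocal v ρ₂)
    (ρ₃ := GaloisRep.toLocal v (mu K (p ^ r))) hC (P.restrict (absGaloisRestrict K (v.adicCompletion K))) ha hb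

/-! ## §2 (AR): the archimedean terms -/

omit [NeZero n] in
/-- **(AR) `loc_w(a ∪ b) = 0` at an infinite place `w` where the second factor dies** (`loc_w b = 0`; e.g. `b = Sh ỹ` with
`H¹(⟨c⟩, ·) = 0` for the complex conjugations, `map_shapiroLift_eq_zero_of_reps` along `Γ_{K_w} → Γ_K`).
[cite: MilneADT2006, Ch. I, Thm. 4.10(b)] [cite: SerreLocalFields1979, VII §5–§6] -/
theorem localization_inl_cupProduct_eq_zero_of_right
    {M₁ M₂ : Type} [AddCommGroup M₁] [TopologicalSpace M₁] [DiscreteTopology M₁]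
    [AddCommGroup M₂] [TopologicalSpace M₂] [DiscreteTopology M₂]
    (ρ₁ : DiscreteGaloisModule K M₁) (ρ₂ : DiscreteGaloisModule K M₂)
    (P : ContPairing ρ₁.toTopRep ρ₂.toTopRep (mu K n).toTopRep) (w : InfinitePlace K)
    (a : galoisCohomology ρ₁ 1) (b : galoisCohomology ρ₂ 1)
    (hb0 : galoisCohomology.localization ρ₂ (Sum.inl w) 1 b = 0) :
    galoisCohomology.localization (mu K n) (Sum.inl w) 2 (P.cupProduct a b) = 0 := by
  haveI : CompactSpace (absoluteGaloisGroup (Place.Completion (Sum.inl w : Place K))) := absoluteGaloisGroup_compactSpace _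
  refine (ContPairing.cupProduct_res P (absGaloisRestrict K (Place.Completion (Sum.inl w : Place K))) a b).trans ?_
  have hb : ContinuousCohomology.map (absGaloisRestrict K (Place.Completion (Sum.inl w : Place K)))
      (𝟙 (TopRep.res (absGaloisRestrict K (Place.Completion (Sum.inl w : Place K)) :
        absoluteGaloisGroup (Place.Completion (Sum.inl w : Place K)) →* absoluteGaloisGroup K) ρ₂.toTopRep)) 1 b = 0 := hb0
  rw [hb]
  exact map_zero _

omit [NeZero n] in
/-- **(AR), left factor**: `loc_w(a ∪ b) = 0` at an infinite place `w` where `loc_w a = 0`. [cite: MilneADT2006, Ch. I, Thm. 4.10(b)] -/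
theorem localization_inl_cupProduct_eq_zero_of_left
    {M₁ M₂ : Type} [AddCommGroup M₁] [TopologicalSpace M₁] [DiscreteTopology M₁]
    [AddCommGroup M₂] [TopologicalSpace M₂] [DiscreteTopology M₂]
    (ρ₁ : DiscreteGaloisModule K M₁) (ρ₂ : DiscreteGaloisModule K M₂)
    (P : ContPairing ρ₁.toTopRep ρ₂.toTopRep (mu K n).toTopRep) (w : InfinitePlace K)
    (a : galoisCohomology ρ₁ 1) (b : galoisCohomology ρ₂ 1)
    (ha0 : galoisCohomology.localization ρ₁ (Sum.inl w) 1 a = 0) :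
    galoisCohomology.localization (mu K n) (Sum.inl w) 2 (P.cupProduct a b) = 0 := by
  haveI : CompactSpace (absoluteGaloisGroup (Place.Completion (Sum.inl w : Place K))) := absoluteGaloisGroup_compactSpace _
  refine (ContPairing.cupProduct_res P (absGaloisRestrict K (Place.Completion (Sum.inl w : Place K))) a b).trans ?_
  have ha : ContinuousCohomology.map (absGaloisRestrict K (Place.Completion (Sum.inl w : Place K)))
      (𝟙 (TopRep.res (absGaloisRestrict K (Place.Completion (Sum.inl w : Place K)) :
        absoluteGaloisGroup (Place.Completion (Sum.inl w : Place K)) →* absoluteGaloisGroup K) ρ₁.toTopRep)) 1 a = 0 := ha0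
  rw [ha, map_zero]
  exact LinearMap.zero_apply _

/-- **Exact reciprocity for a cup product whose second factor dies at every infinite place**: if the invariants of `a ∪ b` vanish
at the finite places outside `T` and `loc_w b = 0` for every infinite `w`, then `Σ_{v ∈ T} inv_v loc_v(a ∪ b) = 0` on the nose
(`sum_localInvariantMap_eq_zero_of_localization_inl_eq_zero` + (AR)). [cite: MilneADT2006, Ch. I, Thm. 4.10(b)] -/
theorem sum_localInvariantMap_cupProduct_eq_zero_of_right
    {M₁ M₂ : Type} [AddCommGroup M₁] [TopologicalSpace M₁] [DiscreteTopology M₁]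
    [AddCommGroup M₂] [TopologicalSpace M₂] [DiscreteTopology M₂]
    (ρ₁ : DiscreteGaloisModule K M₁) (ρ₂ : DiscreteGaloisModule K M₂)
    (P : ContPairing ρ₁.toTopRep ρ₂.toTopRep (mu K n).toTopRep) (T : Finset (HeightOneSpectrum (𝓞 K)))
    (a : galoisCohomology ρ₁ 1) (b : galoisCohomology ρ₂ 1)
    (h : ∀ v : HeightOneSpectrum (𝓞 K), v ∉ T →
      localInvariantMap K n v (galoisCohomology.localization (mu K n) (Sum.inr v) 2 (P.cupProduct a b)) = 0)
    (hb0 : ∀ w : InfinitePlace K, galoisCohomology.localization ρ₂ (Sum.inl w) 1 b = 0) :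
    ∑ v ∈ T, localInvariantMap K n v (galoisCohomology.localization (mu K n) (Sum.inr v) 2 (P.cupProduct a b)) = 0 :=
  sum_localInvariantMap_eq_zero_of_localization_inl_eq_zero K n T _ h fun w ↦
    localization_inl_cupProduct_eq_zero_of_right K n ρ₁ ρ₂ P w a b (hb0 w)

/-! ## §3 (ShU): a Shapiro lift is unramified at `v` when its conjugates are principal on the inertia group -/

/-- **(ShU) A Shapiro lift localises into `H¹_ur(K_v, Maps(Γ_K ⧸ U, M))`** as soon as, for every coset representative `s(y₀)`,
the conjugate crossed homomorphism `i ↦ ψ(s(y₀)⁻¹ · i|_{K̄} · s(y₀))` is principal on the INERTIA group `I_v = absInertia K_v`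
(`= (s(y₀)⁻¹ i|_{K̄} s(y₀)) • b − b` for one `b ∈ M` whenever the conjugate lies in `U`). Proof: `loc_v[Sh ψ] = [Sh ψ ∘ ( ·|_{K̄})]`
is unramified iff principal on `I_v` (`oneCocycleClass_mem_unramifiedSubgroup_iff_exists`), and along `I_v → Γ_{K_v} → Γ_K` the
Shapiro cocycle is a coboundary on the nose, orbit by orbit (`exists_shapiroCocycle_comp_eq_coboundary_of_reps`). Inputs in the
application (`U = Γ_{ℚ_n}`, `v ∉ 2S₀`): Kato classes in `integralH1` (vanishing on `Γ_n ⊓ I_𝔓`), Selmer classes unramified outside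
`2S₀` with divisible coefficients. [cite: NeukirchSchmidtWingberg2008, I §5 (1.5.6)–(1.5.7) and I §6 Prop. (1.6.4)]
[cite: MilneADT2006, Ch. I §2 (unramified cohomology)] -/
theorem localization_shapiroLift_mem_unramifiedSubgroup
    {M : Type} [AddCommGroup M] [TopologicalSpace M] [DiscreteTopology M] (ρ : DiscreteGaloisModule K M)
    (U : Subgroup (absoluteGaloisGroup K)) (hU : IsOpen (U : Set (absoluteGaloisGroup K)))
    [Fintype (absoluteGaloisGroup K ⧸ U)]
    {s : absoluteGaloisGroup K ⧸ U → absoluteGaloisGroup K} (hs : ∀ x, (s x : absoluteGaloisGroup K ⧸ U) = x)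
    (hs1 : s ((1 : absoluteGaloisGroup K) : absoluteGaloisGroup K ⧸ U) = 1) (v : HeightOneSpectrum (𝓞 K))
    (ψ : contOneCocycles (subgroupRep ρ.toTopRep U))
    (hinert : ∀ y₀ : absoluteGaloisGroup K ⧸ U, ∃ b : M, ∀ i ∈ absInertia (v.adicCompletion K),
      ∀ hd : (s y₀)⁻¹ * absGaloisRestrict K (v.adicCompletion K) i * s y₀ ∈ U,
        ψ.1 ⟨(s y₀)⁻¹ * absGaloisRestrict K (v.adicCompletion K) i * s y₀, hd⟩ =
          ρ.toTopRep.ρ ((s y₀)⁻¹ * absGaloisRestrict K (v.adicCompletion K) i * s y₀) b - b) :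
    galoisCohomology.localization (ρ.coind U hU) (Sum.inr v) 1
        (shapiroLift ρ.toTopRep U hU hs hs1 (oneCocycleClass _ ψ)) ∈
      unramifiedSubgroup (GaloisRep.toLocal v (ρ.coind U hU)) 1 := by
  rw [shapiroLift_oneCocycleClass]
  -- the localisation of the class of the Shapiro cocycle is the class of its pull-back along `Γ_{K_v} → Γ_K`
  have e := galoisCohomology.res_oneCocycleClass (ρ.coind U hU) (v.adicCompletion K) (shapiroCocycle ρ.toTopRep U hU hs ψ)
  change galoisCohomology.res (ρ.coind U hU) (v.adicCompletion K) 1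
      (oneCocycleClass (ρ.coind U hU).toTopRep (shapiroCocycle ρ.toTopRep U hU hs ψ)) ∈
    DiscreteGaloisModule.unramifiedSubgroup (GaloisRep.toLocal v (ρ.coind U hU)) 1
  rw [e]
  refine (DiscreteGaloisModule.oneCocycleClass_mem_unramifiedSubgroup_iff_exists (GaloisRep.toLocal v (ρ.coind U hU)) _).mpr ?_
  -- orbit-by-orbit coboundary along `I_v → Γ_{K_v} → Γ_K`
  obtain ⟨Φ, hΦ⟩ := exists_shapiroCocycle_comp_eq_coboundary_of_reps ρ.toTopRep U hU
    ((absGaloisRestrict K (v.adicCompletion K)).comp (subgroupIncl (absInertia (v.adicCompletion K)))) hs ψ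
    (fun y₀ ↦ by
      obtain ⟨b, hb⟩ := hinert y₀
      exact ⟨b, fun d hd ↦ hb d.1 d.2 hd⟩)
  exact ⟨Φ, fun τ hτ ↦ hΦ ⟨τ, hτ⟩⟩

/-- **(ShU), classes form**: the same for a class `c ∈ H¹(U, M)` all of whose representatives' conjugates … — stated for the class of
a given cocycle `ψ` with the hypothesis on `ψ`; this corollary only repackages the conclusion for `Sh c` with `c = [ψ]`.
[cite: NeukirchSchmidtWingberg2008, I §6 Prop. (1.6.4)] -/
theorem localization_shapiroLift_mem_unramifiedSubgroup_of_eq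
    {M : Type} [AddCommGroup M] [TopologicalSpace M] [DiscreteTopology M] (ρ : DiscreteGaloisModule K M)
    (U : Subgroup (absoluteGaloisGroup K)) (hU : IsOpen (U : Set (absoluteGaloisGroup K)))
    [Fintype (absoluteGaloisGroup K ⧸ U)]
    {s : absoluteGaloisGroup K ⧸ U → absoluteGaloisGroup K} (hs : ∀ x, (s x : absoluteGaloisGroup K ⧸ U) = x)
    (hs1 : s ((1 : absoluteGaloisGroup K) : absoluteGaloisGroup K ⧸ U) = 1) (v : HeightOneSpectrum (𝓞 K))
    (c : continuousCohomology 1 (subgroupRep ρ.toTopRep U)) (ψ : contOneCocycles (subgroupRep ρ.toTopRep U))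
    (hc : oneCocycleClass _ ψ = c)
    (hinert : ∀ y₀ : absoluteGaloisGroup K ⧸ U, ∃ b : M, ∀ i ∈ absInertia (v.adicCompletion K),
      ∀ hd : (s y₀)⁻¹ * absGaloisRestrict K (v.adicCompletion K) i * s y₀ ∈ U,
        ψ.1 ⟨(s y₀)⁻¹ * absGaloisRestrict K (v.adicCompletion K) i * s y₀, hd⟩ =
          ρ.toTopRep.ρ ((s y₀)⁻¹ * absGaloisRestrict K (v.adicCompletion K) i * s y₀) b - b) :
    galoisCohomology.localization (ρ.coind U hU) (Sum.inr v) 1 (shapiroLift ρ.toTopRep U hU hs hs1 c) ∈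
      unramifiedSubgroup (GaloisRep.toLocal v (ρ.coind U hU)) 1 := by
  subst hc
  exact localization_shapiroLift_mem_unramifiedSubgroup K ρ U hU hs hs1 v ψ hinert

/-! ## §4 The composed core identities for two Shapiro lifts -/

/-- **The core `2 •` identity in invariant currency.** For discrete `Γ_K`-modules `M₁, M₂`, an open subgroup `U ≤ Γ_K` of finite
index, a pairing `P : Maps(Γ_K ⧸ U, M₁) × Maps(Γ_K ⧸ U, M₂) → μₙ` (`n` a power of the prime `p`) and two continuous crossed
homomorphisms `ψ₁ : U → M₁`, `ψ₂ : U → M₂` whose conjugates are principal on inertia at every finite place outside the finite set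
`T`: `2 • Σ_{v ∈ T} inv_v loc_v(Sh ψ₁ ∪ Sh ψ₂) = 0` ((ShU) + (U) feed `two_nsmul_sum_localInvariantMap_eq_zero_of_localization_eq_zero`).
The `T`-terms are then computed orbit by orbit (`map_cupProduct_coindFin_shapiroLift[_sum]`).
[cite: MilneADT2006, Ch. I, Thm. 2.6 and Thm. 4.10(b)] [cite: NeukirchSchmidtWingberg2008, I §6 Prop. (1.6.4)] -/
theorem two_nsmul_sum_localInvariantMap_cupProduct_shapiroLift_eq_zero {p : ℕ} [Fact p.Prime] (hn : ∃ r : ℕ, n = p ^ r)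
    {M₁ M₂ : Type} [AddCommGroup M₁] [TopologicalSpace M₁] [DiscreteTopology M₁]
    [AddCommGroup M₂] [TopologicalSpace M₂] [DiscreteTopology M₂]
    (ρ₁ : DiscreteGaloisModule K M₁) (ρ₂ : DiscreteGaloisModule K M₂)
    (U : Subgroup (absoluteGaloisGroup K)) (hU : IsOpen (U : Set (absoluteGaloisGroup K)))
    [Fintype (absoluteGaloisGroup K ⧸ U)]
    {s : absoluteGaloisGroup K ⧸ U → absoluteGaloisGroup K} (hs : ∀ x, (s x : absoluteGaloisGroup K ⧸ U) = x)
    (hs1 : s ((1 : absoluteGaloisGroup K) : absoluteGaloisGroup K ⧸ U) = 1)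
    (P : ContPairing (ρ₁.coind U hU).toTopRep (ρ₂.coind U hU).toTopRep (mu K n).toTopRep)
    (T : Finset (HeightOneSpectrum (𝓞 K)))
    (ψ₁ : contOneCocycles (subgroupRep ρ₁.toTopRep U)) (ψ₂ : contOneCocycles (subgroupRep ρ₂.toTopRep U))
    (hinert₁ : ∀ v : HeightOneSpectrum (𝓞 K), v ∉ T → ∀ y₀ : absoluteGaloisGroup K ⧸ U, ∃ b : M₁,
      ∀ i ∈ absInertia (v.adicCompletion K), ∀ hd : (s y₀)⁻¹ * absGaloisRestrict K (v.adicCompletion K) i * s y₀ ∈ U,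
        ψ₁.1 ⟨(s y₀)⁻¹ * absGaloisRestrict K (v.adicCompletion K) i * s y₀, hd⟩ =
          ρ₁.toTopRep.ρ ((s y₀)⁻¹ * absGaloisRestrict K (v.adicCompletion K) i * s y₀) b - b)
    (hinert₂ : ∀ v : HeightOneSpectrum (𝓞 K), v ∉ T → ∀ y₀ : absoluteGaloisGroup K ⧸ U, ∃ b : M₂,
      ∀ i ∈ absInertia (v.adicCompletion K), ∀ hd : (s y₀)⁻¹ * absGaloisRestrict K (v.adicCompletion K) i * s y₀ ∈ U,
        ψ₂.1 ⟨(s y₀)⁻¹ * absGaloisRestrict K (v.adicCompletion K) i * s y₀, hd⟩ =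
          ρ₂.toTopRep.ρ ((s y₀)⁻¹ * absGaloisRestrict K (v.adicCompletion K) i * s y₀) b - b) :
    2 • ∑ v ∈ T, localInvariantMap K n v (galoisCohomology.localization (mu K n) (Sum.inr v) 2
      (P.cupProduct (shapiroLift ρ₁.toTopRep U hU hs hs1 (oneCocycleClass _ ψ₁))
        (shapiroLift ρ₂.toTopRep U hU hs hs1 (oneCocycleClass _ ψ₂)))) = 0 := by
  refine two_nsmul_sum_localInvariantMap_eq_zero_of_localization_eq_zero K n T _ fun v hv ↦ ?_
  exact localization_cupProduct_eq_zero_of_mem_unramifiedSubgroup K n hn (ρ₁.coind U hU) (ρ₂.coind U hU) P v _ _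
    (localization_shapiroLift_mem_unramifiedSubgroup K ρ₁ U hU hs hs1 v ψ₁ (hinert₁ v hv))
    (localization_shapiroLift_mem_unramifiedSubgroup K ρ₂ U hU hs hs1 v ψ₂ (hinert₂ v hv))

/-- **The exact core identity**: as above, and `loc_w(Sh ψ₂) = 0` at every infinite place `w` (e.g. `H¹(⟨c⟩, M₂) = 0` for the complex
conjugations `c`, `map_shapiroLift_eq_zero_of_reps` along `Γ_{K_w} → Γ_K`) — then `Σ_{v ∈ T} inv_v loc_v(Sh ψ₁ ∪ Sh ψ₂) = 0` on the nose.
[cite: MilneADT2006, Ch. I, Thm. 2.6 and Thm. 4.10(b)] [cite: NeukirchSchmidtWingberg2008, I §6 Prop. (1.6.4)] -/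
theorem sum_localInvariantMap_cupProduct_shapiroLift_eq_zero_of_right {p : ℕ} [Fact p.Prime] (hn : ∃ r : ℕ, n = p ^ r)
    {M₁ M₂ : Type} [AddCommGroup M₁] [TopologicalSpace M₁] [DiscreteTopology M₁]
    [AddCommGroup M₂] [TopologicalSpace M₂] [DiscreteTopology M₂]
    (ρ₁ : DiscreteGaloisModule K M₁) (ρ₂ : DiscreteGaloisModule K M₂)
    (U : Subgroup (absoluteGaloisGroup K)) (hU : IsOpen (U : Set (absoluteGaloisGroup K)))
    [Fintype (absoluteGaloisGroup K ⧸ U)]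
    {s : absoluteGaloisGroup K ⧸ U → absoluteGaloisGroup K} (hs : ∀ x, (s x : absoluteGaloisGroup K ⧸ U) = x)
    (hs1 : s ((1 : absoluteGaloisGroup K) : absoluteGaloisGroup K ⧸ U) = 1)
    (P : ContPairing (ρ₁.coind U hU).toTopRep (ρ₂.coind U hU).toTopRep (mu K n).toTopRep)
    (T : Finset (HeightOneSpectrum (𝓞 K)))
    (ψ₁ : contOneCocycles (subgroupRep ρ₁.toTopRep U)) (ψ₂ : contOneCocycles (subgroupRep ρ₂.toTopRep U))
    (hinert₁ : ∀ v : HeightOneSpectrum (𝓞 K), v ∉ T → ∀ y₀ : absoluteGaloisGroup K ⧸ U, ∃ b : M₁,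
      ∀ i ∈ absInertia (v.adicCompletion K), ∀ hd : (s y₀)⁻¹ * absGaloisRestrict K (v.adicCompletion K) i * s y₀ ∈ U,
        ψ₁.1 ⟨(s y₀)⁻¹ * absGaloisRestrict K (v.adicCompletion K) i * s y₀, hd⟩ =
          ρ₁.toTopRep.ρ ((s y₀)⁻¹ * absGaloisRestrict K (v.adicCompletion K) i * s y₀) b - b)
    (hinert₂ : ∀ v : HeightOneSpectrum (𝓞 K), v ∉ T → ∀ y₀ : absoluteGaloisGroup K ⧸ U, ∃ b : M₂,
      ∀ i ∈ absInertia (v.adicCompletion K), ∀ hd : (s y₀)⁻¹ * absGaloisRestrict K (v.adicCompletion K) i * s y₀ ∈ U,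
        ψ₂.1 ⟨(s y₀)⁻¹ * absGaloisRestrict K (v.adicCompletion K) i * s y₀, hd⟩ =
          ρ₂.toTopRep.ρ ((s y₀)⁻¹ * absGaloisRestrict K (v.adicCompletion K) i * s y₀) b - b)
    (hinf : ∀ w : InfinitePlace K, galoisCohomology.localization (ρ₂.coind U hU) (Sum.inl w) 1
      (shapiroLift ρ₂.toTopRep U hU hs hs1 (oneCocycleClass _ ψ₂)) = 0) :
    ∑ v ∈ T, localInvariantMap K n v (galoisCohomology.localization (mu K n) (Sum.inr v) 2
      (P.cupProduct (shapiroLift ρ₁.toTopRep U hU hs hs1 (oneCocycleClass _ ψ₁))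
        (shapiroLift ρ₂.toTopRep U hU hs hs1 (oneCocycleClass _ ψ₂)))) = 0 := by
  refine sum_localInvariantMap_cupProduct_eq_zero_of_right K n (ρ₁.coind U hU) (ρ₂.coind U hU) P T _ _ (fun v hv ↦ ?_) hinf
  rw [localization_cupProduct_eq_zero_of_mem_unramifiedSubgroup K n hn (ρ₁.coind U hU) (ρ₂.coind U hU) P v _ _
    (localization_shapiroLift_mem_unramifiedSubgroup K ρ₁ U hU hs hs1 v ψ₁ (hinert₁ v hv))
    (localization_shapiroLift_mem_unramifiedSubgroup K ρ₂ U hU hs hs1 v ψ₂ (hinert₂ v hv)), map_zero]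

/-! ## §5 Vanishing of the localisation of a Shapiro lift (locally principal conjugates): the archimedean input -/

/-- **`loc_w(Sh ψ) = 0` at an INFINITE place `w`** as soon as every conjugate `d ↦ ψ(s(y₀)⁻¹ · d|_{K̄} · s(y₀))` of `ψ` is
principal on the decomposition group `Γ_{K_w}` (`≅ 1` or `ℤ/2`): the tree's `map_shapiroLift_eq_zero_of_reps` along
`Γ_{K_w} → Γ_K`. In the application (`U = Γ_{ℚ_n}`, `ℚ_n` totally real so every complex conjugation lies in `U`) the hypothesis
is `H¹(⟨c_y⟩, M) = 0` for the conjugate involutions `c_y = s(y₀)⁻¹ c s(y₀)` — e.g. `M` an induced `ℤ[C₂]`-module (S-A at finite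
level). This is the input `hinf`/`hb0` of the EXACT forms of §2/§4. [cite: NeukirchSchmidtWingberg2008, I §6 Prop. (1.6.4)]
[cite: MilneADT2006, Ch. I, Thm. 4.10(b)] -/
theorem localization_inl_shapiroLift_eq_zero
    {M : Type} [AddCommGroup M] [TopologicalSpace M] [DiscreteTopology M] (ρ : DiscreteGaloisModule K M)
    (U : Subgroup (absoluteGaloisGroup K)) (hU : IsOpen (U : Set (absoluteGaloisGroup K)))
    [Fintype (absoluteGaloisGroup K ⧸ U)]
    {s : absoluteGaloisGroup K ⧸ U → absoluteGaloisGroup K} (hs : ∀ x, (s x : absoluteGaloisGroup K ⧸ U) = x)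
    (hs1 : s ((1 : absoluteGaloisGroup K) : absoluteGaloisGroup K ⧸ U) = 1) (w : InfinitePlace K)
    (ψ : contOneCocycles (subgroupRep ρ.toTopRep U))
    (hreal : ∀ y₀ : absoluteGaloisGroup K ⧸ U, ∃ b : M,
      ∀ (d : absoluteGaloisGroup (Place.Completion (Sum.inl w : Place K)))
        (hd : (s y₀)⁻¹ * absGaloisRestrict K (Place.Completion (Sum.inl w : Place K)) d * s y₀ ∈ U),
        ψ.1 ⟨(s y₀)⁻¹ * absGaloisRestrict K (Place.Completion (Sum.inl w : Place K)) d * s y₀, hd⟩ =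
          ρ.toTopRep.ρ ((s y₀)⁻¹ * absGaloisRestrict K (Place.Completion (Sum.inl w : Place K)) d * s y₀) b - b) :
    galoisCohomology.localization (ρ.coind U hU) (Sum.inl w) 1
      (shapiroLift ρ.toTopRep U hU hs hs1 (oneCocycleClass _ ψ)) = 0 :=
  map_shapiroLift_eq_zero_of_reps ρ.toTopRep U hU (absGaloisRestrict K (Place.Completion (Sum.inl w : Place K)))
    hs hs1 ψ hreal

/-- **`loc_v(Sh ψ) = 0` at a FINITE place `v`** as soon as every conjugate of `ψ` is principal on the whole decomposition group
`Γ_{K_v}` (locally TRIVIAL layer classes — the `p`-primitive situation of crux K3's `…LayerAwayTrivial`; for merely UNRAMIFIED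
classes use §3). [cite: NeukirchSchmidtWingberg2008, I §6 Prop. (1.6.4)] -/
theorem localization_inr_shapiroLift_eq_zero
    {M : Type} [AddCommGroup M] [TopologicalSpace M] [DiscreteTopology M] (ρ : DiscreteGaloisModule K M)
    (U : Subgroup (absoluteGaloisGroup K)) (hU : IsOpen (U : Set (absoluteGaloisGroup K)))
    [Fintype (absoluteGaloisGroup K ⧸ U)]
    {s : absoluteGaloisGroup K ⧸ U → absoluteGaloisGroup K} (hs : ∀ x, (s x : absoluteGaloisGroup K ⧸ U) = x)
    (hs1 : s ((1 : absoluteGaloisGroup K) : absoluteGaloisGroup K ⧸ U) = 1) (v : HeightOneSpectrum (𝓞 K))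
    (ψ : contOneCocycles (subgroupRep ρ.toTopRep U))
    (htriv : ∀ y₀ : absoluteGaloisGroup K ⧸ U, ∃ b : M, ∀ (d : absoluteGaloisGroup (v.adicCompletion K))
        (hd : (s y₀)⁻¹ * absGaloisRestrict K (v.adicCompletion K) d * s y₀ ∈ U),
        ψ.1 ⟨(s y₀)⁻¹ * absGaloisRestrict K (v.adicCompletion K) d * s y₀, hd⟩ =
          ρ.toTopRep.ρ ((s y₀)⁻¹ * absGaloisRestrict K (v.adicCompletion K) d * s y₀) b - b) :
    galoisCohomology.localization (ρ.coind U hU) (Sum.inr v) 1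
      (shapiroLift ρ.toTopRep U hU hs hs1 (oneCocycleClass _ ψ)) = 0 :=
  map_shapiroLift_eq_zero_of_reps ρ.toTopRep U hU (absGaloisRestrict K (v.adicCompletion K)) hs hs1 ψ htriv

/-- **The exact core identity, cocycle-level input at the real places**: for two Shapiro lifts `Sh ψ₁`, `Sh ψ₂` whose conjugates
are principal on inertia at every finite place outside `T`, and such that every conjugate of `ψ₂` is principal on each
archimedean decomposition group, `Σ_{v ∈ T} inv_v loc_v(Sh ψ₁ ∪ Sh ψ₂) = 0` on the nose (§4 + `localization_inl_shapiroLift_eq_zero`).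
[cite: MilneADT2006, Ch. I, Thm. 2.6 and Thm. 4.10(b)] [cite: NeukirchSchmidtWingberg2008, I §6 Prop. (1.6.4)] -/
theorem sum_localInvariantMap_cupProduct_shapiroLift_eq_zero_of_real {p : ℕ} [Fact p.Prime] (hn : ∃ r : ℕ, n = p ^ r)
    {M₁ M₂ : Type} [AddCommGroup M₁] [TopologicalSpace M₁] [DiscreteTopology M₁]
    [AddCommGroup M₂] [TopologicalSpace M₂] [DiscreteTopology M₂]
    (ρ₁ : DiscreteGaloisModule K M₁) (ρ₂ : DiscreteGaloisModule K M₂)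
    (U : Subgroup (absoluteGaloisGroup K)) (hU : IsOpen (U : Set (absoluteGaloisGroup K)))
    [Fintype (absoluteGaloisGroup K ⧸ U)]
    {s : absoluteGaloisGroup K ⧸ U → absoluteGaloisGroup K} (hs : ∀ x, (s x : absoluteGaloisGroup K ⧸ U) = x)
    (hs1 : s ((1 : absoluteGaloisGroup K) : absoluteGaloisGroup K ⧸ U) = 1)
    (P : ContPairing (ρ₁.coind U hU).toTopRep (ρ₂.coind U hU).toTopRep (mu K n).toTopRep)
    (T : Finset (HeightOneSpectrum (𝓞 K)))
    (ψ₁ : contOneCocycles (subgroupRep ρ₁.toTopRep U)) (ψ₂ : contOneCocycles (subgroupRep ρ₂.toTopRep U))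
    (hinert₁ : ∀ v : HeightOneSpectrum (𝓞 K), v ∉ T → ∀ y₀ : absoluteGaloisGroup K ⧸ U, ∃ b : M₁,
      ∀ i ∈ absInertia (v.adicCompletion K), ∀ hd : (s y₀)⁻¹ * absGaloisRestrict K (v.adicCompletion K) i * s y₀ ∈ U,
        ψ₁.1 ⟨(s y₀)⁻¹ * absGaloisRestrict K (v.adicCompletion K) i * s y₀, hd⟩ =
          ρ₁.toTopRep.ρ ((s y₀)⁻¹ * absGaloisRestrict K (v.adicCompletion K) i * s y₀) b - b)
    (hinert₂ : ∀ v : HeightOneSpectrum (𝓞 K), v ∉ T → ∀ y₀ : absoluteGaloisGroup K ⧸ U, ∃ b : M₂,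
      ∀ i ∈ absInertia (v.adicCompletion K), ∀ hd : (s y₀)⁻¹ * absGaloisRestrict K (v.adicCompletion K) i * s y₀ ∈ U,
        ψ₂.1 ⟨(s y₀)⁻¹ * absGaloisRestrict K (v.adicCompletion K) i * s y₀, hd⟩ =
          ρ₂.toTopRep.ρ ((s y₀)⁻¹ * absGaloisRestrict K (v.adicCompletion K) i * s y₀) b - b)
    (hreal₂ : ∀ (w : InfinitePlace K) (y₀ : absoluteGaloisGroup K ⧸ U), ∃ b : M₂,
      ∀ (d : absoluteGaloisGroup (Place.Completion (Sum.inl w : Place K)))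
        (hd : (s y₀)⁻¹ * absGaloisRestrict K (Place.Completion (Sum.inl w : Place K)) d * s y₀ ∈ U),
        ψ₂.1 ⟨(s y₀)⁻¹ * absGaloisRestrict K (Place.Completion (Sum.inl w : Place K)) d * s y₀, hd⟩ =
          ρ₂.toTopRep.ρ ((s y₀)⁻¹ * absGaloisRestrict K (Place.Completion (Sum.inl w : Place K)) d * s y₀) b - b) :
    ∑ v ∈ T, localInvariantMap K n v (galoisCohomology.localization (mu K n) (Sum.inr v) 2
      (P.cupProduct (shapiroLift ρ₁.toTopRep U hU hs hs1 (oneCocycleClass _ ψ₁))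
        (shapiroLift ρ₂.toTopRep U hU hs hs1 (oneCocycleClass _ ψ₂)))) = 0 :=
  sum_localInvariantMap_cupProduct_shapiroLift_eq_zero_of_right K n hn ρ₁ ρ₂ U hU hs hs1 P T ψ₁ ψ₂ hinert₁ hinert₂
    fun w ↦ localization_inl_shapiroLift_eq_zero K ρ₂ U hU hs hs1 w ψ₂ (hreal₂ w)

/-! ## §6 The archimedean term from the INVOLUTIONS: `loc_w(Sh ψ) = 0` when the conjugate complex conjugations have no
antifixed classes modulo coboundaries (`{a | c a = −a} ⊆ {c b − b}`; e.g. an induced `ℤ[C₂]`-module) -/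

/-- In a group of order `≤ 2` every element squares to `1`. [folklore] -/
private theorem mul_self_eq_one_of_natCard_le_two {G : Type*} [Group G] [Finite G] (hG : Nat.card G ≤ 2) (d : G) :
    d * d = 1 := by
  have hpos : 0 < Nat.card G := Nat.card_pos
  have hpow : d ^ Nat.card G = 1 := pow_card_eq_one'
  interval_cases h : Nat.card G
  · rw [pow_one] at hpow
    rw [hpow, mul_one]
  · rwa [pow_two] at hpow

/-- In a group of order `≤ 2` two non-identity elements coincide. [folklore] -/
private theorem eq_of_ne_one_of_natCard_le_two {G : Type*} [Group G] [Finite G] (hG : Nat.card G ≤ 2) {d d' : G}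
    (hd : d ≠ 1) (hd' : d' ≠ 1) : d = d' := by
  classical
  by_contra hne
  haveI := Fintype.ofFinite G
  have hn1 : (1 : G) ∉ ({d, d'} : Finset G) := by
    simp only [Finset.mem_insert, Finset.mem_singleton, not_or]
    exact ⟨fun h ↦ hd h.symm, fun h ↦ hd' h.symm⟩
  have hn2 : d ∉ ({d'} : Finset G) := by
    simp only [Finset.mem_singleton]
    exact hne
  have h3 : ({1, d, d'} : Finset G).card = 3 := by
    rw [Finset.card_insert_of_notMem hn1, Finset.card_insert_of_notMem hn2, Finset.card_singleton]
  have hle := Finset.card_le_univ ({1, d, d'} : Finset G)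
  rw [h3, ← Nat.card_eq_fintype_card] at hle
  omega

/-- **(T∞) `loc_w(Sh ψ) = 0` at an infinite place from the INVOLUTIONS alone.** `Γ_{K_w}` has order `≤ 2`
(`natCard_absoluteGaloisGroup_placeCompletion_inl_le_two`); for its non-trivial element `d` (if any) and a coset representative `s(y₀)` with
`c := s(y₀)⁻¹ · d|_{K̄} · s(y₀) ∈ U` (an involution of `U`), the cocycle identity gives `c • ψ(c) = −ψ(c)`; so if every such conjugate
involution `c` has **no antifixed vectors modulo coboundaries** on `M` — `c • a = −a ⟹ a = c • b − b` (`hanti`; e.g. `M` a regular `(R/I)[C₂]`-module: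
k2-g9's S-A on the habitat `Δ_W < 0`) — then all conjugates of `ψ` are principal on `Γ_{K_w}` and `loc_w(Sh ψ) = 0` (§5). This is the EXACT
archimedean input of `sum_localInvariantMap_cupProduct_shapiroLift_eq_zero_of_real`. [cite: MilneADT2006, Ch. I, Thm. 2.13 and Thm. 4.10 (b)]
[cite: NeukirchSchmidtWingberg2008, I §6 Prop. (1.6.4)] -/
theorem localization_inl_shapiroLift_eq_zero_of_forall_antifixed
    {M : Type} [AddCommGroup M] [TopologicalSpace M] [DiscreteTopology M] (ρ : DiscreteGaloisModule K M)
    (U : Subgroup (absoluteGaloisGroup K)) (hU : IsOpen (U : Set (absoluteGaloisGroup K)))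
    [Fintype (absoluteGaloisGroup K ⧸ U)]
    {s : absoluteGaloisGroup K ⧸ U → absoluteGaloisGroup K} (hs : ∀ x, (s x : absoluteGaloisGroup K ⧸ U) = x)
    (hs1 : s ((1 : absoluteGaloisGroup K) : absoluteGaloisGroup K ⧸ U) = 1) (w : InfinitePlace K)
    (ψ : contOneCocycles (subgroupRep ρ.toTopRep U))
    (hanti : ∀ (y₀ : absoluteGaloisGroup K ⧸ U) (d : absoluteGaloisGroup (Place.Completion (Sum.inl w : Place K))), d ≠ 1 →
      (s y₀)⁻¹ * absGaloisRestrict K (Place.Completion (Sum.inl w : Place K)) d * s y₀ ∈ U →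
      ∀ a : M, ρ.toTopRep.ρ ((s y₀)⁻¹ * absGaloisRestrict K (Place.Completion (Sum.inl w : Place K)) d * s y₀) a = -a →
        ∃ b : M, a = ρ.toTopRep.ρ ((s y₀)⁻¹ * absGaloisRestrict K (Place.Completion (Sum.inl w : Place K)) d * s y₀) b - b) :
    galoisCohomology.localization (ρ.coind U hU) (Sum.inl w) 1
      (shapiroLift ρ.toTopRep U hU hs hs1 (oneCocycleClass _ ψ)) = 0 := by
  refine localization_inl_shapiroLift_eq_zero K ρ U hU hs hs1 w ψ fun y₀ ↦ ?_
  haveI := finite_absoluteGaloisGroup_placeCompletion_inl K w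
  have hG := natCard_absoluteGaloisGroup_placeCompletion_inl_le_two K w
  -- the trivial element contributes nothing, for any `b`
  have hone : ∀ (b : M) (hd : (s y₀)⁻¹ * absGaloisRestrict K (Place.Completion (Sum.inl w : Place K)) 1 * s y₀ ∈ U),
      ψ.1 ⟨(s y₀)⁻¹ * absGaloisRestrict K (Place.Completion (Sum.inl w : Place K)) 1 * s y₀, hd⟩ =
        ρ.toTopRep.ρ ((s y₀)⁻¹ * absGaloisRestrict K (Place.Completion (Sum.inl w : Place K)) 1 * s y₀) b - b := by
    intro b hd
    have e1 : (s y₀)⁻¹ * absGaloisRestrict K (Place.Completion (Sum.inl w : Place K)) 1 * s y₀ = 1 := by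
      rw [map_one, mul_one, inv_mul_cancel]
    have e2 : (⟨(s y₀)⁻¹ * absGaloisRestrict K (Place.Completion (Sum.inl w : Place K)) 1 * s y₀, hd⟩ : U) = 1 :=
      Subtype.ext e1
    rw [e2, contOneCocycles.apply_one, e1, map_one]
    exact (sub_self _).symm
  by_cases hex : ∃ d : absoluteGaloisGroup (Place.Completion (Sum.inl w : Place K)), d ≠ 1 ∧
      (s y₀)⁻¹ * absGaloisRestrict K (Place.Completion (Sum.inl w : Place K)) d * s y₀ ∈ U
  · obtain ⟨d, hd1, hdU⟩ := hex
    set c : U := ⟨(s y₀)⁻¹ * absGaloisRestrict K (Place.Completion (Sum.inl w : Place K)) d * s y₀, hdU⟩ with hc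
    -- `c` is an involution of `U`
    have hcc : c * c = 1 := by
      apply Subtype.ext
      change ((s y₀)⁻¹ * absGaloisRestrict K (Place.Completion (Sum.inl w : Place K)) d * s y₀) *
          ((s y₀)⁻¹ * absGaloisRestrict K (Place.Completion (Sum.inl w : Place K)) d * s y₀) = 1
      have e : ((s y₀)⁻¹ * absGaloisRestrict K (Place.Completion (Sum.inl w : Place K)) d * s y₀) *
          ((s y₀)⁻¹ * absGaloisRestrict K (Place.Completion (Sum.inl w : Place K)) d * s y₀) =
          (s y₀)⁻¹ * absGaloisRestrict K (Place.Completion (Sum.inl w : Place K)) (d * d) * s y₀ := by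
        rw [map_mul]; group
      rw [e, mul_self_eq_one_of_natCard_le_two hG d, map_one, mul_one, inv_mul_cancel]
    -- the cocycle identity at `c * c = 1`: `c • ψ(c) = -ψ(c)`
    have ha : ρ.toTopRep.ρ ((s y₀)⁻¹ * absGaloisRestrict K (Place.Completion (Sum.inl w : Place K)) d * s y₀) (ψ.1 c) =
        -(ψ.1 c) := by
      have h := subgroup_cocycle_mul ρ.toTopRep U ψ c c
      rw [hcc, contOneCocycles.apply_one] at h
      exact (eq_neg_of_add_eq_zero_right h.symm)
    obtain ⟨b, hb⟩ := hanti y₀ d hd1 hdU (ψ.1 c) ha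
    refine ⟨b, fun d' hd' ↦ ?_⟩
    by_cases h1 : d' = 1
    · subst h1
      exact hone b hd'
    · have hdd : d' = d := eq_of_ne_one_of_natCard_le_two hG h1 hd1
      subst hdd
      exact hb
  · push Not at hex
    refine ⟨0, fun d' hd' ↦ ?_⟩
    by_cases h1 : d' = 1
    · subst h1
      exact hone 0 hd'
    · exact absurd hd' (hex d' h1)

end Literature.NumberTheory.GaloisCohomology

end
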